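import Summits.Ventures.Crystal3D.Theorems.StickyWulffConstantCoaxialWallLawSeamUnionCore
import HarnessLib

/-!
# The STAR-SITE closure of the union core: a window ball at a slot position of a CLOSED VERTEX STAR of the core joins the core
# (crux `CoaxialWallLaw`, stmt-Ventures-19481; line `WallLedgerF`, skeleton 'CoaxialWallLawCertificates', repair of the v8.2 input `stub_unionCoreCap`)

HONEST FRAMING. Venture `Summits/Ventures/Crystal3D` (cell `crystal3d-full`); DEFINITIONS + closure lemmas for the REPAIR of lane F's union-core input
(`TailResidue.UnionCoreCap s`, '…SeamUnionCoreCloser', refuted for every `s` in '…SeamUnionCoreCapRefuted': the cap table `capTable₂` has no closed-vertex-star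
row, so a lone exact cluster has capped pool `0` at its loaded balls).  The E1 row «a core ball carrying a closed vertex star of the core has `≤ 11 − deg_core`
junk contacts» is valid (under `P5Exhaustion`) only for cores that are closed under the STAR-SITE rule: by E1 a twelve-fold ball over a closed slot star has
the slot dozen or a twin dozen as shell, and those balls must then already be core balls — slot-position balls by the star-site rule, mirrored balls because
they cap a hexagon-pair triangle.  This file builds that closure; the row and the repaired functional are in the sequels.  Nothing about the stubs is claimed;
F-C1 not moved.
* `StarSiteIn D x` — `x = y + A w` for a core ball `y`, a frame `A`, a slot `w`, with the closed vertex star `{y + A u : 0 < ⟪u, δ⟫}` of some slot `δ` inside `D`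
  (monotone in `D`);
* `starStep W D = D ∪ {x ∈ W | x caps a unit triangle of D ∨ StarSiteIn D x}`, `starIter`, `starClosure W D₀ := starIter W D₀ (#W + 1)`, fixed point
  `starStep_starClosure`, maximality `mem_starClosure_of_capsTriangleIn` / `mem_starClosure_of_starSiteIn`;
* `IsStarClosed X z D` — cap-closed in the payer window AND closed under the star-site rule; `IsStarClosed.capClosed`;
* **`unionCoreStar Y z v S₁ S₂`** := the star closure of `unionCore` in the payer window; `isStarClosed_unionCoreStar`, `unionCore_subset_unionCoreStar`,
  **`isEndPairA_unionCoreStar`** — every (A)-end pair of `Y` ending within `1` of `z` is an (A)-end pair of the star-closed union core (descent to a cap-closed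
  superset of the reader's / target's piece, '…SeamUnionCore').
-/

noncomputable section

namespace Summit.Ventures.Crystal3D.Theorems

namespace TailResidue

open Summit.Ventures.Crystal3D Finset
open scoped InnerProductSpace

/-! ### Star sites -/

/-- **STAR SITE of the core `D`**: `x = y + A w` for a core ball `y ∈ D`, a frame `A` and a slot `w`, where the CLOSED VERTEX STAR `{y + A u : 0 < ⟪u, δ⟫}` of some
slot `δ` (five balls) lies in `D`. -/
def StarSiteIn (D : Finset (EuclideanSpace ℝ (Fin 3))) (x : EuclideanSpace ℝ (Fin 3)) : Prop :=
  ∃ y ∈ D, ∃ A : EuclideanSpace ℝ (Fin 3) ≃ₗᵢ[ℝ] EuclideanSpace ℝ (Fin 3), ∃ δ ∈ fccSlots,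
    (∀ u ∈ fccSlots, 0 < ⟪u, δ⟫_ℝ → y + A u ∈ D) ∧ ∃ w ∈ fccSlots, x = y + A w

/-- Being a star site is monotone in the core. -/
theorem StarSiteIn.mono {D D' : Finset (EuclideanSpace ℝ (Fin 3))} {x : EuclideanSpace ℝ (Fin 3)} (h : StarSiteIn D x) (hD : D ⊆ D') : StarSiteIn D' x := by
  obtain ⟨y, hy, A, δ, hδ, hstar, w, hw, hx⟩ := h
  exact ⟨y, hD hy, A, δ, hδ, fun u hu hpos => hD (hstar u hu hpos), w, hw, hx⟩

/-! ### The star closure -/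

section Closure

variable (W : Finset (EuclideanSpace ℝ (Fin 3)))

open scoped Classical in
/-- One step of the star closure inside the window `W`: add the window balls that cap a unit triangle of `D` or sit at a star site of `D`. -/
def starStep (D : Finset (EuclideanSpace ℝ (Fin 3))) : Finset (EuclideanSpace ℝ (Fin 3)) := D ∪ W.filter fun x => CapsTriangleIn D x ∨ StarSiteIn D x

/-- Iterated star steps. -/
def starIter (D₀ : Finset (EuclideanSpace ℝ (Fin 3))) : ℕ → Finset (EuclideanSpace ℝ (Fin 3))
  | 0 => D₀
  | n + 1 => starStep W (starIter D₀ n)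

/-- **The star closure** of `D₀` inside `W` (`#W + 1` steps suffice). -/
def starClosure (D₀ : Finset (EuclideanSpace ℝ (Fin 3))) : Finset (EuclideanSpace ℝ (Fin 3)) := starIter W D₀ (W.card + 1)

variable {W}

/-- A step only adds balls. -/
theorem subset_starStep (D : Finset (EuclideanSpace ℝ (Fin 3))) : D ⊆ starStep W D := subset_union_left

open scoped Classical in
/-- A step stays inside the window. -/
theorem starStep_subset {D : Finset (EuclideanSpace ℝ (Fin 3))} (hD : D ⊆ W) : starStep W D ⊆ W := union_subset hD (filter_subset _ _)

open scoped Classical in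
/-- Membership in a step. -/
theorem mem_starStep_iff {D : Finset (EuclideanSpace ℝ (Fin 3))} {x : EuclideanSpace ℝ (Fin 3)} :
    x ∈ starStep W D ↔ x ∈ D ∨ (x ∈ W ∧ (CapsTriangleIn D x ∨ StarSiteIn D x)) := by
  simp only [starStep, mem_union, mem_filter]

/-- The successor stage. -/
theorem starIter_succ (D₀ : Finset (EuclideanSpace ℝ (Fin 3))) (n : ℕ) : starIter W D₀ (n + 1) = starStep W (starIter W D₀ n) := rfl

/-- Stages grow. -/
theorem subset_starIter_succ (D₀ : Finset (EuclideanSpace ℝ (Fin 3))) (n : ℕ) : starIter W D₀ n ⊆ starIter W D₀ (n + 1) := subset_starStep _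

/-- Every stage contains the seed. -/
theorem subset_starIter (D₀ : Finset (EuclideanSpace ℝ (Fin 3))) (n : ℕ) : D₀ ⊆ starIter W D₀ n := by
  induction n with
  | zero => exact Subset.rfl
  | succ n ih => exact ih.trans (subset_starIter_succ D₀ n)

/-- Stages stay inside the window. -/
theorem starIter_subset {D₀ : Finset (EuclideanSpace ℝ (Fin 3))} (hD : D₀ ⊆ W) (n : ℕ) : starIter W D₀ n ⊆ W := by
  induction n with
  | zero => exact hD
  | succ n ih => exact starStep_subset ih

/-- Once a step adds nothing, no later step does. -/
theorem starIter_stable (D₀ : Finset (EuclideanSpace ℝ (Fin 3))) {n : ℕ} (h : starIter W D₀ (n + 1) = starIter W D₀ n) (k : ℕ) :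
    starIter W D₀ (n + k) = starIter W D₀ n := by
  induction k with
  | zero => rfl
  | succ k ih => rw [← add_assoc, starIter_succ, ih, ← starIter_succ, h]

/-- **The star closure is a fixed point of the star step** (pigeonhole inside `W`). -/
theorem starStep_starClosure {D₀ : Finset (EuclideanSpace ℝ (Fin 3))} (hD : D₀ ⊆ W) : starStep W (starClosure W D₀) = starClosure W D₀ := by
  obtain ⟨n, hn, hfix⟩ : ∃ n ≤ W.card, starIter W D₀ (n + 1) = starIter W D₀ n := by
    by_contra h
    push Not at h
    have hgrow : ∀ n ≤ W.card + 1, n ≤ (starIter W D₀ n).card := by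
      intro n hn
      induction n with
      | zero => exact Nat.zero_le _
      | succ n ih =>
        have hlt : (starIter W D₀ n).card < (starIter W D₀ (n + 1)).card :=
          card_lt_card (lt_of_le_of_ne (subset_starIter_succ D₀ n) (Ne.symm (h n (by omega))))
        have := ih (by omega)
        omega
    have h1 := hgrow (W.card + 1) le_rfl
    have h2 : (starIter W D₀ (W.card + 1)).card ≤ W.card := card_le_card (starIter_subset hD _)
    omega
  have hclo : starClosure W D₀ = starIter W D₀ n := by
    rw [starClosure, show W.card + 1 = n + (W.card + 1 - n) by omega]
    exact starIter_stable D₀ hfix _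
  rw [hclo, ← starIter_succ, hfix]

/-- **Maximality (capping)**: a window ball capping a unit triangle of the star closure belongs to it. -/
theorem mem_starClosure_of_capsTriangleIn {D₀ : Finset (EuclideanSpace ℝ (Fin 3))} (hD : D₀ ⊆ W) {x : EuclideanSpace ℝ (Fin 3)} (hx : x ∈ W)
    (hcap : CapsTriangleIn (starClosure W D₀) x) : x ∈ starClosure W D₀ := by
  rw [← starStep_starClosure hD, mem_starStep_iff]
  exact Or.inr ⟨hx, Or.inl hcap⟩

/-- **Maximality (star sites)**: a window ball at a star site of the star closure belongs to it. -/
theorem mem_starClosure_of_starSiteIn {D₀ : Finset (EuclideanSpace ℝ (Fin 3))} (hD : D₀ ⊆ W) {x : EuclideanSpace ℝ (Fin 3)} (hx : x ∈ W)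
    (hst : StarSiteIn (starClosure W D₀) x) : x ∈ starClosure W D₀ := by
  rw [← starStep_starClosure hD, mem_starStep_iff]
  exact Or.inr ⟨hx, Or.inr hst⟩

/-- The star closure contains the seed. -/
theorem subset_starClosure (D₀ : Finset (EuclideanSpace ℝ (Fin 3))) : D₀ ⊆ starClosure W D₀ := subset_starIter D₀ _

/-- The star closure stays inside the window. -/
theorem starClosure_subset {D₀ : Finset (EuclideanSpace ℝ (Fin 3))} (hD : D₀ ⊆ W) : starClosure W D₀ ⊆ W := starIter_subset hD _

end Closure

/-! ### Star-closed cores -/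

/-- **STAR-CLOSED CORE** in the payer window: cap-closed (`IsCapClosed`) and every window ball at a star site of `D` belongs to `D`. -/
def IsStarClosed (X : Finset (EuclideanSpace ℝ (Fin 3))) (z : EuclideanSpace ℝ (Fin 3)) (D : Finset (EuclideanSpace ℝ (Fin 3))) : Prop :=
  IsCapClosed X z D ∧ ∀ x ∈ X, dist z x ≤ 3 → StarSiteIn D x → x ∈ D

namespace IsStarClosed

variable {X D : Finset (EuclideanSpace ℝ (Fin 3))} {z : EuclideanSpace ℝ (Fin 3)}

/-- A star-closed core is cap-closed. -/
theorem capClosed (h : IsStarClosed X z D) : IsCapClosed X z D := h.1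

/-- A star-closed core lies in the configuration. -/
theorem subset (h : IsStarClosed X z D) : D ⊆ X := h.1.subset

/-- The star-site rule. -/
theorem mem_of_starSiteIn (h : IsStarClosed X z D) {x : EuclideanSpace ℝ (Fin 3)} (hx : x ∈ X) (hzx : dist z x ≤ 3) (hst : StarSiteIn D x) : x ∈ D :=
  h.2 x hx hzx hst

end IsStarClosed

open scoped Classical in
/-- The star closure, in the payer window, of a subset of the window is star-closed. -/
theorem isStarClosed_starClosure {X : Finset (EuclideanSpace ℝ (Fin 3))} {z : EuclideanSpace ℝ (Fin 3)} {D₀ : Finset (EuclideanSpace ℝ (Fin 3))}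
    (hD : D₀ ⊆ X.filter fun x => dist z x ≤ 3) : IsStarClosed X z (starClosure (X.filter fun x => dist z x ≤ 3) D₀) :=
  ⟨⟨fun _ hx => mem_filter.1 (starClosure_subset hD hx), fun _ hx hzx hcap => mem_starClosure_of_capsTriangleIn hD (mem_filter.2 ⟨hx, hzx⟩) hcap⟩,
    fun _ hx hzx hst => mem_starClosure_of_starSiteIn hD (mem_filter.2 ⟨hx, hzx⟩) hst⟩

/-! ### The star-closed union core -/

section Union

variable (Y : Finset (EuclideanSpace ℝ (Fin 3))) (z : EuclideanSpace ℝ (Fin 3)) (v : WordVersion) (S₁ S₂ : PlateSystem)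

open scoped Classical in
/-- **THE STAR-CLOSED UNION CORE of the payer `z`**: the star closure, inside the payer window `Y ∩ B̄(z, 3)`, of the union core `unionCore Y z v S₁ S₂`. -/
def unionCoreStar : Finset (EuclideanSpace ℝ (Fin 3)) :=
  starClosure (Y.filter fun x => dist z x ≤ 3) (unionCore Y z v S₁ S₂)

variable {Y z v S₁ S₂}

open scoped Classical in
/-- The union core lies in the payer window. -/
theorem unionCore_subset_window : unionCore Y z v S₁ S₂ ⊆ Y.filter fun x => dist z x ≤ 3 :=
  fun x hx => mem_filter.2 ((isCapClosed_unionCore (Y := Y) (z := z) (v := v) (S₁ := S₁) (S₂ := S₂)).1 x hx)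

open scoped Classical in
/-- The star-closed union core is star-closed (in particular cap-closed) in the payer window. -/
theorem isStarClosed_unionCoreStar : IsStarClosed Y z (unionCoreStar Y z v S₁ S₂) := isStarClosed_starClosure unionCore_subset_window

open scoped Classical in
/-- The union core lies in its star closure. -/
theorem unionCore_subset_unionCoreStar : unionCore Y z v S₁ S₂ ⊆ unionCoreStar Y z v S₁ S₂ := subset_starClosure _

open scoped Classical in
/-- The star-closed union core lies in the configuration. -/
theorem unionCoreStar_subset : unionCoreStar Y z v S₁ S₂ ⊆ Y := isStarClosed_unionCoreStar.subset

open scoped Classical in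
/-- **Every (A)-end pair ending within `1` of the payer is an (A)-end pair of the star-closed union core** (descent to a cap-closed superset of the reader's piece
for straight moves, of the target's twin piece for cross moves). -/
theorem isEndPairA_unionCoreStar (hY : ∀ p ∈ Y, ∀ p' ∈ Y, p ≠ p' → 1 ≤ dist p p') (h₁ : S₁.RT ⊆ fccSlots) (h₂ : S₂.RT ⊆ fccSlots) {b q : EuclideanSpace ℝ (Fin 3)}
    (hzb : dist z b ≤ 1) (hp : IsEndPairA Y v S₁ S₂ b q) : IsEndPairA (unionCoreStar Y z v S₁ S₂) v S₁ S₂ b q := by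
  have hD := (isStarClosed_unionCoreStar (Y := Y) (z := z) (v := v) (S₁ := S₁) (S₂ := S₂)).capClosed
  obtain ⟨hq, hb, hpay, G, d, hadm, hqd, hmove⟩ := id hp
  rcases hmove with ⟨hrd, hbq, hnm⟩ | ⟨m, htw, hdm, hbq, hnm⟩
  · have hpP := isEndPairA_pieceOf_of_straight hY h₁ h₂ hzb hq hb hpay hadm hqd hrd hbq hnm
    exact isEndPairA_of_closed_superset_straight hY h₁ h₂ hD ((pieceOf_subset_unionCore hzb hp hpP).trans unionCore_subset_unionCoreStar) hzb hq hb hpay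
      hadm hqd hrd hbq hnm
  · have hpP := isEndPairA_pieceOf_of_cross hY h₁ h₂ hzb hq hb hpay hadm hqd htw hdm hbq hnm
    exact isEndPairA_of_closed_superset_cross hY h₁ h₂ hD ((pieceOf_subset_unionCore hzb hp hpP).trans unionCore_subset_unionCoreStar) hzb hq hb hpay hadm
      hqd htw hdm hbq hnm

open scoped Classical in
/-- The end multiplicity of a ball within `1` of the payer does not drop in the star-closed union core. -/
theorem endMultA_le_unionCoreStar (hY : ∀ p ∈ Y, ∀ p' ∈ Y, p ≠ p' → 1 ≤ dist p p') (h₁ : S₁.RT ⊆ fccSlots) (h₂ : S₂.RT ⊆ fccSlots) {b : EuclideanSpace ℝ (Fin 3)}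
    (hzb : dist z b ≤ 1) : endMultA Y v S₁ S₂ b ≤ endMultA (unionCoreStar Y z v S₁ S₂) v S₁ S₂ b := by
  unfold endMultA
  refine card_le_card fun q hq => ?_
  obtain ⟨-, hp⟩ := mem_filter.1 hq
  have hp' := isEndPairA_unionCoreStar hY h₁ h₂ hzb hp
  exact mem_filter.2 ⟨hp'.1, hp'⟩

end Union

end TailResidue

end Summit.Ventures.Crystal3D.Theorems

end
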